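import Summits.KontsevichZagierPeriods.Zeta5Search.LaiSweepFree

/-!
# Order-cell sweep certificates for the `κ₃` point, 4/6: the cell exponent is a lower bound

HONEST FRAMING. Systematic-search bookkeeping for the `κ₃` point `(74, 2180, 444; δ74)` of
`LaiKappa3Assembly`; no irrationality claim unless certified — this file checks no shard of the `κ₃`
sweep and proves nothing about `ζ(5)`.

The delicate lemma `passed_mono_P`: on a free open cell `(u, v)` the passing order of two jumps is
dominated by the lexicographic order of the exact keys `keyP = (tpn, a, type)` read at `u⁺` — the
difference of the two phase functions is affine with slope `a_T − a_T'`, has no zero on `(u, v)`,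
and its sign at `u⁺` is the key comparison (`keyP_le_decode`, `passedQ_of_cmp`). With `evalSum_eq`
(`φ̃ = Σ base + Σ jumps over the y-terms`) this gives the soundness of the engine's cell evaluation.

## Main results

* `Sweep.passed_mono_P`, `Sweep.evalSum_eq`.
* `Sweep.cellEval_sound`: for a free cell `[p/q, v)`, `(cellEval ts const p q L).1 ≤ const + Σ ts
  (x, y)` for all `x ∈ [p/q, v)`, `y ∈ [0, 1)`, and the returned decorated list is again a
  permutation of the `y`-terms (so it can seed the next cell).
-/

open Finset Literature.NumberTheory.Transcendental.Zudilin2004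
open Literature.NumberTheory.Transcendental.Zudilin2004.PhiCert

namespace Summit.KontsevichZagierPeriods.Zeta5Search

open SavingCheck

namespace Sweep

/-! ### Soundness, V: keys on the open cell -/

/-- The jump point just right of `u` is `tpn/q`. [folklore] -/
theorem tpn_spec (a : ℤ) (p q : ℕ) (hq : 0 < q) :
    (a : ℚ) * ((p : ℚ) / q) - (flP a p q : ℚ) = ((tpn a p q : ℕ) : ℚ) / q := by
  have hq' : (0 : ℚ) < q := by exact_mod_cast hq
  obtain ⟨h, _⟩ := flfr_spec a p q hq
  rw [mul_div_assoc] at h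
  unfold flP tpn
  cases hw : wrap a (flfr a p q).2
  · simp only [cond_false]; linarith
  · have hfr : (flfr a p q).2 = 0 := by
      unfold wrap at hw
      simp only [Bool.and_eq_true, beq_iff_eq, decide_eq_true_eq] at hw
      exact hw.2
    simp only [cond_true]
    rw [hfr, Nat.cast_zero, zero_div, add_zero] at h
    push_cast
    rw [div_self hq'.ne']
    linarith

/-- Decoding the second key: lexicographic `(tpn, a, tbit)`. [folklore] -/
theorem keyP_le_decode {p q : ℕ} {T₁ T₂ : Term} (_hA₁ : T₁.a.natAbs < A0) (hA₂ : T₂.a.natAbs < A0)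
    (hk : keyP p q T₁ ≤ keyP p q T₂) :
    tpn T₁.a p q < tpn T₂.a p q ∨
      (tpn T₁.a p q = tpn T₂.a p q ∧ (T₁.a < T₂.a ∨ (T₁.a = T₂.a ∧ tbit T₁ ≤ tbit T₂))) := by
  have hb₁ := tbit_le_one T₁
  have hb₂ := tbit_le_one T₂
  unfold keyP A0 at hk
  unfold A0 at hA₂
  omega

/-- Comparison of jump points and types transfers passedness. [folklore] -/
theorem passedQ_of_cmp {T₁ T₂ : Term} {t₁ t₂ y : ℚ} (h1 : isY T₁ = true)
    (hcmp : t₁ < t₂ ∨ (t₁ = t₂ ∧ tbit T₁ ≤ tbit T₂)) (h : passedQ T₂ t₂ y) : passedQ T₁ t₁ y := by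
  rcases T₁ with ⟨c₁, k₁, a₁⟩
  rcases T₂ with ⟨c₂, k₂, a₂⟩
  cases k₁ <;> cases k₂ <;> simp only [passedQ, isY, Bool.false_eq_true] at h h1 ⊢ <;>
    rcases hcmp with h' | ⟨h', htb⟩ <;> first | linarith | simp [tbit] at htb

/-- **Monotonicity on the open cell**: along the `keyP` order the passed terms form a down-set at
every
point of a breakpoint-free cell `(u, v)`. [folklore] -/
theorem passed_mono_P {p q : ℕ} (hq : 0 < q) {T₁ T₂ : Term} (h1 : isY T₁ = true)
    (hA₁ : T₁.a.natAbs < A0) (hA₂ : T₂.a.natAbs < A0)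
    (hk : keyP p q T₁ ≤ keyP p q T₂) {v x : ℚ} (hux : (p : ℚ) / q < x) (hxv : x < v)
    (hf₁ : T₁.a ≠ 0 → Free T₁.a ((p : ℚ) / q) v) (hf₂ : T₂.a ≠ 0 → Free T₂.a ((p : ℚ) / q) v)
    (hf₁₂ : T₁.a ≠ T₂.a → Free (T₁.a - T₂.a) ((p : ℚ) / q) v) (y : ℚ)
    (h : passedQ T₂ (Int.fract ((T₂.a : ℚ) * x)) y) :
    passedQ T₁ (Int.fract ((T₁.a : ℚ) * x)) y := by
  have hq' : (0 : ℚ) < q := by exact_mod_cast hq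
  have e₁ : Int.fract ((T₁.a : ℚ) * x) = (T₁.a : ℚ) * x - (flP T₁.a p q : ℚ) := by
    rw [Int.fract, floor_eq_flP hq hux hxv hf₁]
  have e₂ : Int.fract ((T₂.a : ℚ) * x) = (T₂.a : ℚ) * x - (flP T₂.a p q : ℚ) := by
    rw [Int.fract, floor_eq_flP hq hux hxv hf₂]
  have s₁ := tpn_spec T₁.a p q hq
  have s₂ := tpn_spec T₂.a p q hq
  set u := (p : ℚ) / q with hu
  have hcmp : Int.fract ((T₁.a : ℚ) * x) < Int.fract ((T₂.a : ℚ) * x) ∨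
      (Int.fract ((T₁.a : ℚ) * x) = Int.fract ((T₂.a : ℚ) * x) ∧ tbit T₁ ≤ tbit T₂) := by
    rcases keyP_le_decode hA₁ hA₂ hk with hlt | ⟨heq, hlt | ⟨haa, htb⟩⟩
    · left
      rw [e₁, e₂]
      by_contra hle
      push Not at hle
      have hgu : (T₁.a : ℚ) * u - flP T₁.a p q < (T₂.a : ℚ) * u - flP T₂.a p q := by
        rw [s₁, s₂]; exact div_lt_div_of_pos_right (by exact_mod_cast hlt) hq'
      by_cases haa : T₁.a = T₂.a
      · rw [haa] at hgu hle
        linarith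
      · set d : ℚ := (T₂.a : ℚ) - T₁.a with hd
        set gu : ℚ := ((T₂.a : ℚ) * u - flP T₂.a p q) - ((T₁.a : ℚ) * u - flP T₁.a p q)
          with hgu_def
        set gx : ℚ := ((T₂.a : ℚ) * x - flP T₂.a p q) - ((T₁.a : ℚ) * x - flP T₁.a p q)
          with hgx_def
        have hgu0 : 0 < gu := by rw [hgu_def]; linarith
        have hgx0 : gx ≤ 0 := by rw [hgx_def]; linarith
        have hgxu : gx - gu = d * (x - u) := by rw [hgx_def, hgu_def, hd]; ring
        have hden : 0 < gu - gx := by linarith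
        have hxu : 0 < x - u := by linarith
        set z : ℚ := u + (x - u) * gu / (gu - gx) with hz
        have hzu : u < z := by
          have : 0 < (x - u) * gu / (gu - gx) := div_pos (mul_pos hxu hgu0) hden
          rw [hz]; linarith
        have hzx : z ≤ x := by
          have : (x - u) * gu / (gu - gx) ≤ x - u := by
            rw [div_le_iff₀ hden]; nlinarith
          rw [hz]; linarith
        have hgz : (T₂.a : ℚ) * z - flP T₂.a p q - ((T₁.a : ℚ) * z - flP T₁.a p q) = 0 := by
          have e : (T₂.a : ℚ) * z - flP T₂.a p q - ((T₁.a : ℚ) * z - flP T₁.a p q) =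
              gu + d * (z - u) := by rw [hgu_def, hd]; ring
          have hz' : d * (z - u) = (d * (x - u)) * gu / (gu - gx) := by rw [hz]; ring
          rw [e, hz', ← hgxu]
          field_simp
          ring
        apply hf₁₂ haa z hzu (lt_of_le_of_lt hzx hxv) (flP T₁.a p q - flP T₂.a p q)
        push_cast
        linarith
    · left
      rw [e₁, e₂]
      have hgu : (T₁.a : ℚ) * u - flP T₁.a p q = (T₂.a : ℚ) * u - flP T₂.a p q := by
        rw [s₁, s₂, heq]
      have hlt' : (T₁.a : ℚ) < T₂.a := by exact_mod_cast hlt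
      have hxu : 0 < x - u := by linarith
      nlinarith
    · right
      refine ⟨?_, htb⟩
      rw [e₁, e₂, haa]
  exact passedQ_of_cmp h1 hcmp h

/-! ### Soundness, VI: the cell evaluation is a lower bound -/

/-- First component of `bSums`. [folklore] -/
theorem bSums_fst (p q : ℕ) : ∀ ts : List Term,
    (bSums p q ts).1 = (ts.map fun T => bPartF T (flfr T.a p q).1).sum
  | [] => rfl
  | T :: ts => by simp only [bSums, List.map_cons, List.sum_cons, bSums_fst p q ts]

/-- Second component of `bSums`: the base parts at `u⁺`. [folklore] -/
theorem bSums_snd (p q : ℕ) : ∀ ts : List Term,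
    (bSums p q ts).2 = (ts.map fun T => bPartF T (flP T.a p q)).sum
  | [] => rfl
  | T :: ts => by simp only [bSums, List.map_cons, List.sum_cons, bSums_snd p q ts, flP]

/-- `y`-free terms have no jump. [folklore] -/
theorem jumpQ_of_not_isY (T : Term) (t y : ℚ) (h : isY T = false) : jumpQ T t y = 0 := by
  rcases T with ⟨c, k, a⟩; cases k <;> simp_all [isY, jumpQ]

/-- A sum vanishing off the `y`-terms restricts to them. [folklore] -/
theorem sum_filter_isY (g : Term → ℤ) (hg : ∀ T, isY T = false → g T = 0) :
    ∀ ts : List Term, (ts.map g).sum = ((ts.filter isY).map g).sum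
  | [] => rfl
  | T :: ts => by
    rw [List.filter_cons, List.map_cons, List.sum_cons, sum_filter_isY g hg ts]
    cases h : isY T
    · simp [hg T h]
    · simp

/-- `φ̃ = Σ base + Σ_{y-terms} jump` for `y ∈ [0,1)`. [folklore] -/
theorem evalSum_eq (ts : List Term) (x y : ℚ) (hy0 : 0 ≤ y) (hy1 : y < 1) :
    evalSum ts x y = (ts.map fun T => bPartF T ⌊(T.a : ℚ) * x⌋).sum +
      ((ts.filter isY).map fun T => jumpQ T (Int.fract ((T.a : ℚ) * x)) y).sum := by
  unfold evalSum
  rw [List.map_congr_left (fun T (_ : T ∈ ts) => eval_eq_base_add_jump T x y hy0 hy1),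
    List.sum_map_add]
  congr 1
  exact sum_filter_isY _ (fun T hT => jumpQ_of_not_isY T _ y hT) ts

/-- **Soundness of the cell evaluation.** If `L` carries the `y`-terms of `ts` and `(u, v)` is
breakpoint-free, then `cellEval` returns the `y`-terms again (re-sorted) and a lower bound of
`const + φ̃_ts` on `[u, v) × [0, 1)`. [cite: Zudilin2004, §8 p. 271] -/
theorem cellEval_sound (ts : List Term) (const : ℤ) {p q : ℕ} (hq : 0 < q) (L : List DTerm)
    (hL : List.Perm (L.map (·.1)) (ts.filter isY)) (hA : ∀ T ∈ ts, T.a.natAbs < A0) {v : ℚ}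
    (hfree : FreeAll ts ((p : ℚ) / q) v) :
    List.Perm ((cellEval ts const p q L).2.map (·.1)) (ts.filter isY) ∧
    ∀ x y : ℚ, (p : ℚ) / q ≤ x → x < v → 0 ≤ y → y < 1 →
      (cellEval ts const p q L).1 ≤ const + evalSum ts x y := by
  set D := L.map (deco p q) with hD
  set S₁ := D.insertionSort leU with hS₁
  set S₂ := S₁.insertionSort leP with hS₂
  have hDfst : D.map (·.1) = L.map (·.1) := by rw [hD, List.map_map]; rfl
  have hp₁ : List.Perm S₁ D := List.perm_insertionSort _ _
  have hp₂ : List.Perm S₂ S₁ := List.perm_insertionSort _ _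
  have hS₁fst : List.Perm (S₁.map (·.1)) (ts.filter isY) := by
    have := hp₁.map (fun z : DTerm => z.1); rw [hDfst] at this; exact this.trans hL
  have hS₂fst : List.Perm (S₂.map (·.1)) (ts.filter isY) := (hp₂.map _).trans hS₁fst
  have hok : ∀ z ∈ D, DecoOK p q z := fun z hz => by
    obtain ⟨w, _, rfl⟩ := List.mem_map.1 hz; exact deco_ok p q w
  have hok₁ : ∀ z ∈ S₁, DecoOK p q z := fun z hz => hok z (hp₁.mem_iff.1 hz)
  have hok₂ : ∀ z ∈ S₂, DecoOK p q z := fun z hz => hok₁ z (hp₂.mem_iff.1 hz)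
  have hsort₁ : S₁.Pairwise leU := List.pairwise_insertionSort _ _
  have hsort₂ : S₂.Pairwise leP := List.pairwise_insertionSort _ _
  have hmem₁ : ∀ z ∈ S₁, z.1 ∈ ts.filter isY := fun z hz =>
    hS₁fst.mem_iff.1 (List.mem_map.2 ⟨z, hz, rfl⟩)
  have hmem₂ : ∀ z ∈ S₂, z.1 ∈ ts.filter isY := fun z hz =>
    hS₂fst.mem_iff.1 (List.mem_map.2 ⟨z, hz, rfl⟩)
  have hE : cellEval ts const p q L = (min ((bSums p q ts).1 + const + minPrefixD S₁)
      ((bSums p q ts).2 + const + minPrefixD S₂), S₂) := rfl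
  rw [hE]
  refine ⟨hS₂fst, fun x y hux hxv hy0 hy1 => ?_⟩
  rw [evalSum_eq ts x y hy0 hy1]
  rcases hux.eq_or_lt with hxe | hux'
  · -- at the left endpoint: first key
    subst hxe
    refine (min_le_left _ _).trans ?_
    have hB : (bSums p q ts).1 = (ts.map fun T => bPartF T ⌊(T.a : ℚ) * ((p : ℚ) / q)⌋).sum := by
      rw [bSums_fst]; congr 1; apply List.map_congr_left; intro T _
      rw [flfr_fst T.a p q hq, mul_div_assoc]
    have hJ : minPrefixD S₁ ≤
        ((ts.filter isY).map fun T => jumpQ T (Int.fract ((T.a : ℚ) * ((p : ℚ) / q))) y).sum := by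
      rw [← (hS₁fst.map _).sum_eq, List.map_map]
      have hpw : S₁.Pairwise (fun a b => passedQ b.1 (Int.fract ((b.1.a : ℚ) * ((p : ℚ) / q))) y →
          passedQ a.1 (Int.fract ((a.1.a : ℚ) * ((p : ℚ) / q))) y) := by
        refine hsort₁.imp_of_mem ?_
        intro a b ha hb hab hpb
        have hab' : keyU p q a.1 ≤ keyU p q b.1 := by
          rw [← (hok₁ a ha).1, ← (hok₁ b hb).1]; exact hab
        have hya : isY a.1 = true := (List.mem_filter.1 (hmem₁ a ha)).2
        have := passed_mono_U hq hya hab' y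
        rw [mul_div_assoc, mul_div_assoc] at this
        exact this hpb
      refine (minPrefixD_le
        (fun T => passedQ T (Int.fract ((T.a : ℚ) * ((p : ℚ) / q))) y) S₁ hpw).trans
        (le_of_eq ?_)
      congr 1
      apply List.map_congr_left
      intro z _
      simp only [Function.comp_apply, jumpQ_eq_ite]
    omega
  · -- in the interior: second key
    refine (min_le_right _ _).trans ?_
    have hB : (bSums p q ts).2 = (ts.map fun T => bPartF T ⌊(T.a : ℚ) * x⌋).sum := by
      rw [bSums_snd]; congr 1; apply List.map_congr_left; intro T hT
      rw [floor_eq_flP hq hux' hxv (fun ha => hfree.slope hT ha)]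
    have hJ : minPrefixD S₂ ≤
        ((ts.filter isY).map fun T => jumpQ T (Int.fract ((T.a : ℚ) * x)) y).sum := by
      rw [← (hS₂fst.map _).sum_eq, List.map_map]
      have hpw : S₂.Pairwise (fun a b => passedQ b.1 (Int.fract ((b.1.a : ℚ) * x)) y →
          passedQ a.1 (Int.fract ((a.1.a : ℚ) * x)) y) := by
        refine hsort₂.imp_of_mem ?_
        intro a b ha hb hab hpb
        have hab' : keyP p q a.1 ≤ keyP p q b.1 := by
          rw [← (hok₂ a ha).2, ← (hok₂ b hb).2]; exact hab
        have hma := hmem₂ a ha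
        have hmb := hmem₂ b hb
        have hya : isY a.1 = true := (List.mem_filter.1 hma).2
        have hta : a.1 ∈ ts := List.mem_of_mem_filter hma
        have htb : b.1 ∈ ts := List.mem_of_mem_filter hmb
        exact passed_mono_P hq hya (hA _ hta) (hA _ htb) hab' hux' hxv
          (fun ha => hfree.slope hta ha) (fun hb => hfree.slope htb hb)
          (fun hne => hfree.pair hma hmb hne) y hpb
      refine (minPrefixD_le (fun T => passedQ T (Int.fract ((T.a : ℚ) * x)) y) S₂ hpw).trans
        (le_of_eq ?_)
      congr 1
      apply List.map_congr_left
      intro z _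
      simp only [Function.comp_apply, jumpQ_eq_ite]
    omega

end Sweep

end Summit.KontsevichZagierPeriods.Zeta5Search
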